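import Literature.Geometry.Kaehler.RiemannSurfaceAbelianCoverCyclicQuotientDecomposition
import HarnessLib

/-!
# Positivity of the Chevalley–Weil multiplicities: every irreducible representation of `G` occurs in `𝓗¹(M)`
# when `g(M/G) ≥ 2` (Lange–Recillas, Theorem 3.1), and `dim B_Q > 0 ⟺ g(Y_Q) ≥ 1` unless `g(Y_Q) = g_S = 1`,
# `Q ≠ 1` (Kopeliovich–Zemel, Corollary 7.4 and the remark following it)

Layer `Literature/Geometry/Kaehler`, sequel of `RiemannSurfaceChevalleyWeilMultiplicities` (the Chevalley–Weil
formula as `dim Hom_G(V, 𝓗¹(M)) = dim V^G + dim V(γ − 1) + Σ_t Σ_α (α/m_t)N_{t,α}`), of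
`RiemannSurfaceCyclicQuotientEigenspaces` (`dim E_{χ̄} + dim E_χ = 2[χ = 1] + 2(γ − 1) + #{q ∈ Br : χ(G_q) ≠ 1}` for
`χ ∈ Ĝ`), of `RiemannSurfaceLinearCharactersIntermediateQuotient` (`Σ_{χ(N)=1} dim E_χ = g(M/N)`,
`#{χ : χ(N) = 1} = [G:N]`) and of `RiemannSurfaceAbelianCoverCyclicQuotientDecomposition` (Theorem 7.3's
`dim B_Q = Σ_{ψ : ker ψ = ker χ} dim E_ψ = φ([G:N])(γ − 1 + [N = G]) + ½φ([G:N])·#{q ∈ Br : G_q ⊄ N}`, `N = ker χ`,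
`Q = G/N`, `Y_Q = M/N`). Sources as printed:

H. Lange, S. Recillas, *Abelian varieties with group action*, J. reine angew. Math. 575 (2004), §3
(arXiv:math/0106055 pp. 5–6):
> First we consider the question which of the abelian varieties `B_i` in (3.1) are nonzero. The next theorem
> implies that if the genus of the quotient `Y = X/G` is `≥ 2`, then `B_i ≠ 0` for all `i`.
> **Theorem 3.1:** Given a Galois covering of smooth projective curves `π : X → Y`, with group `G`, all irreducible
> `ℚ`-representations of `G` appear in the isotypical decomposition of `JX` if `g_Y ≥ 2`.
> (proof) `H¹(X, 𝒪_X) ≅ H¹(Y, π_*𝒪_X) ≅ H¹(Y, 𝒪_Y) ⊕ ⊕_{j=2}^s H¹(Y, ℰ_{V_j})^{dim V_j}`. Hence it suffices to show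
> that `h¹(Y, ℰ_{V_j}) > 0` for all `j ≥ 2`, since then all representations `W_i` will appear in the isotypical
> decomposition of `T₀JX`. […] `h¹(Y, ℰ_{V_j}) = −deg ℰ_{V_j} + dim V_j (g_Y − 1) > 0` if `g_Y ≥ 2`.

Y. Kopeliovich, S. Zemel, Israel J. Math. 234 (2019), §7 (arXiv:1609.02296 pp. 31–33):
> The positivity of the dimensions of these subvarieties for `g_S ≥ 2`, which is Theorem 3.1 of [[LR]], is an
> immediate consequence of Corollary 7.2 (or equivalently of Theorem 5.12 of [[R]]).
> **Corollary 7.4.** […] Moreover, the primitive Prym variety associated with the cyclic quotient `Q` is non-trivial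
> wherever `g_{Y_Q} ≥ 1`, except when `g_{Y_Q} = g_S = 1` and `Q` is not trivial.
> (proof) For `g_{Y_Q} ≥ 1` this number is positive, unless `g_{Y_Q} = 1` and there is no branching (for any
> branching has a positive contribution to the sum over `y`), meaning that `g_S = 1` as well by Corollary 1.?
> The fact that in the cases not covered by the last assertion in Corollary 7.4 the primitive Prym variety
> `P̃(Y_Q/S)` is trivial is obvious: If `g_{Y_Q} = 0` then `J(Y_Q)` itself is trivial, and if `Y_Q` is a
> non-trivial unbranched cover of `S` and both have genus 1 then `J(Y_Q)` is the image of `J(S)` there.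

Here `T₀J(X)^* = Ω(1) = 𝓗¹(M)`; «`V` appears in `T₀J(X)`» is `Hom_G(V^*, 𝓗¹(M)) ≠ 0`, and since `V ↦ V^*`
permutes the irreducible representations, Theorem 3.1 at the level of `T₀` says that `Hom_G(V, 𝓗¹(M)) ≠ 0` for
EVERY non-zero representation `V` of `G` when `γ = g(M/G) ≥ 2` — which is what the Chevalley–Weil formula gives
(`dim Hom_G(V, 𝓗¹(M)) ≥ dim V(γ − 1)`, the third summand being non-negative). The `T₀`-dimension of `B_Q`
(= the image of `P̃(Y_Q/S)`, `Q = G/ker χ`) is `Σ_{ψ ∈ Ĝ : ker ψ = ker χ} dim E_ψ(𝓗¹(M))`, and `g(Y_Q)` is the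
genus of the intermediate orbit surface `M/ker χ` (`ker χ` pushed into `Aut M` as `χ.ker.map G.subtype`).

## What is proved (no definitions, no named facts, no instances)

* §1 THEOREM 3.1 (Lange–Recillas) at `T₀`, any finite `G ≤ Aut M`, any finite-dimensional `(V, ρ)`:
  `finrank_intertwiningMap_oneFormRep_eq_sum_branchValues_real` (the Chevalley–Weil multiplicity over `ℝ`),
  `sum_branchValues_nonneg`, **`finrank_invariants_add_mul_le_finrank_intertwiningMap`**
  (`dim V^G + dim V·(γ − 1) ≤ dim Hom_G(V, 𝓗¹(M))` over `ℤ`), `…_of_one_le` (the same in `ℕ` for `γ ≥ 1`),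
  `finrank_invariants_le_finrank_intertwiningMap` (`γ ≥ 1`), **`finrank_le_finrank_intertwiningMap_of_two_le`**
  (`γ ≥ 2`: `dim V ≤ dim Hom_G(V, 𝓗¹(M))`), **`finrank_intertwiningMap_pos_of_two_le`** /
  `nontrivial_intertwiningMap_of_two_le` («all irreducible representations of `G` appear … if `g_Y ≥ 2`»).
* §2 COROLLARY 7.4 (third assertion) and the remark after it, any finite `G ≤ Aut M`, `χ ∈ Ĝ`, `N = ker χ`,
  `n = [G:N]`, `B = Σ_{ψ : ker ψ = N} dim E_ψ`, `g_Y = g(M/N)`: `ker_inv_char`, the comparison of the branch counts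
  (`card_filter_exists_apply_ne_one_eq`, `card_filter_exists_apply_ne_one_le`, `filter_exists_apply_ne_one_eq_empty_one`),
  `two_mul_sum_filter_ker_eq_finrank_eq_int` (`2B = φ(n)(2γ − 2 + 2[N = G] + #{q : G_q ⊄ N})` over `ℤ`),
  `sum_filter_ker_le_finrank_eq_arithGenus` (`Σ_{ψ(N) = 1} dim E_ψ = g_Y` as a `Finset` sum),
  **`two_mul_arithGenus_orbitSurface_ker_eq`** (RIEMANN–HURWITZ for `Y = M/N → M/G` in character form:
  `2g_Y = 2 + 2(γ − 1)[G:N] + Σ_{ψ(N)=1} #{q ∈ Br : ψ(G_q) ≠ 1}`), `sum_filter_ker_eq_finrank_le_arithGenus`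
  (`B ≤ g_Y`), **`sum_filter_ker_eq_finrank_pos_iff`** (`0 < B ⟺ g_Y ≥ 1 ∧ ¬(g_Y = 1 ∧ γ = 1 ∧ χ ≠ 1)`),
  `sum_filter_ker_eq_finrank_pos_of_two_le` (`γ ≥ 2 ⟹ B > 0` — «the positivity … for `g_S ≥ 2`»),
  `sum_filter_ker_eq_finrank_eq_zero_of_arithGenus_eq_zero` (`g_Y = 0 ⟹ B = 0`) and
  `sum_filter_ker_eq_finrank_eq_zero_of_arithGenus_eq_one` (`g_Y = γ = 1`, `χ ≠ 1 ⟹ B = 0`).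

## References

* H. Lange, S. Recillas, *Abelian varieties with group action*, J. reine angew. Math. 575 (2004), 135–155,
  Theorem 3.1 and its proof (arXiv:math/0106055 pp. 5–6). [LangeRecillas2004]
* Y. Kopeliovich, S. Zemel, *On spaces associated with invariant divisors on Galois covers of Riemann surfaces and
  their applications*, Israel J. Math. 234 (2019), §7: the sentence after Corollary 7.2, Theorem 7.3,
  Corollary 7.4 (third assertion and its proof), and the remark following Corollary 7.4 (arXiv:1609.02296
  pp. 31–33). [KopeliovichZemel2019]
* A. M. Rojas, *Group actions on Jacobian varieties*, Rev. Mat. Iberoam. 23 (2007), Corollary 3.4 (3.3),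
  Theorem 5.12. [Rojas2007]
* H. Lange, R. E. Rodríguez, *Decomposition of Jacobians by Prym varieties*, LNM 2310 (2022), Theorem 3.1.6.
  [LangeRodriguez2022]
-/

noncomputable section

open scoped Manifold ContDiff Topology
open Set Filter Function Complex MulAction Module

namespace Literature.Geometry.Kaehler

namespace RiemannSurface

variable {M : Type*} [TopologicalSpace M] [ChartedSpace ℂ M] [IsManifold 𝓘(ℂ, ℂ) ω M]
  [CompactSpace M] [T2Space M] [PreconnectedSpace M] [Nonempty M] [Finite (autGroup M)]
  (G : Subgroup (autGroup M)) [Fintype ↥G] {V : Type*} [AddCommGroup V] [Module ℂ V] [FiniteDimensional ℂ V]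
  (ρ : Representation ℂ ↥G V)

open OrbitSurface

/-! ### §1 Theorem 3.1 (Lange–Recillas): `dim Hom_G(V, 𝓗¹(M)) ≥ dim V^G + dim V·(γ − 1)` -/

/-- The Chevalley–Weil multiplicity over `ℝ`:
`dim Hom_G(V, 𝓗¹(M)) = dim V^G + dim V(γ − 1) + Σ_q Σ_α (α/m_q)·N_{q,α}`.
[cite: KopeliovichZemel2019, Proposition 7.1] [cite: LangeRecillas2004, Theorem 3.1 (proof)] -/
theorem finrank_intertwiningMap_oneFormRep_eq_sum_branchValues_real :
    (finrank ℂ (Representation.IntertwiningMap ρ ((oneFormRep M).comp G.subtype)) : ℝ) =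
      (finrank ℂ ↥ρ.invariants : ℝ) + (finrank ℂ V : ℝ) * ((arithGenus (OrbitSurface G M) : ℝ) - 1) +
      ∑ q ∈ (branchDiv (mk G : M → OrbitSurface G M)).support,
        ∑ α ∈ Finset.range (stabOrder q),
          (α : ℝ) / (stabOrder q : ℝ) * finrank ℂ ↥(⨅ h : ↥(stabilizer G q.out),
            Module.End.eigenspace (ρ (h : ↥G)) (stabDeriv q.out (h : ↥G) ^ α)) := by
  have h := finrank_intertwiningMap_oneFormRep_eq_sum_branchValues G ρ
  apply Complex.ofReal_injective
  push_cast
  exact h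

omit [CompactSpace M] [Nonempty M] [Fintype ↥G] [FiniteDimensional ℂ V] in
/-- The ramification summand `Σ_q Σ_α (α/m_q)·N_{q,α}` of the Chevalley–Weil formula is non-negative («any
branching has a positive contribution»; `−deg ℰ_V ≥ 0`). [cite: KopeliovichZemel2019, Corollary 7.4 (proof)]
[cite: LangeRecillas2004, Theorem 3.1 (proof)] -/
theorem sum_branchValues_nonneg :
    0 ≤ ∑ q ∈ (branchDiv (mk G : M → OrbitSurface G M)).support,
        ∑ α ∈ Finset.range (stabOrder q),
          (α : ℝ) / (stabOrder q : ℝ) * finrank ℂ ↥(⨅ h : ↥(stabilizer G q.out),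
            Module.End.eigenspace (ρ (h : ↥G)) (stabDeriv q.out (h : ↥G) ^ α)) :=
  Finset.sum_nonneg fun _ _ ↦ Finset.sum_nonneg fun _ _ ↦ by positivity

/-- **`dim V^G + dim V·(γ − 1) ≤ dim Hom_G(V, 𝓗¹(M))`** (over `ℤ`; `γ = g(M/G)`) for every finite-dimensional
representation `V` of a finite `G ≤ Aut M` — «`h¹(Y, ℰ_V) = −deg ℰ_V + dim V(g_Y − 1)`» with `−deg ℰ_V ≥ 0`.
[cite: LangeRecillas2004, Theorem 3.1 (proof)] [cite: KopeliovichZemel2019, Proposition 7.1] -/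
theorem finrank_invariants_add_mul_le_finrank_intertwiningMap :
    (finrank ℂ ↥ρ.invariants : ℤ) + (finrank ℂ V : ℤ) * ((arithGenus (OrbitSurface G M) : ℤ) - 1) ≤
      finrank ℂ (Representation.IntertwiningMap ρ ((oneFormRep M).comp G.subtype)) := by
  have h := finrank_intertwiningMap_oneFormRep_eq_sum_branchValues_real G ρ
  have hS := sum_branchValues_nonneg G ρ
  have h' : ((finrank ℂ ↥ρ.invariants : ℤ) : ℝ) +
      ((finrank ℂ V : ℤ) : ℝ) * (((arithGenus (OrbitSurface G M) : ℤ) : ℝ) - 1) ≤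
      ((finrank ℂ (Representation.IntertwiningMap ρ ((oneFormRep M).comp G.subtype)) : ℤ) : ℝ) := by
    push_cast
    rw [h]
    linarith
  exact_mod_cast h'

/-- `dim V^G + dim V·(γ − 1) ≤ dim Hom_G(V, 𝓗¹(M))` in `ℕ` when `γ ≥ 1`. [cite: LangeRecillas2004, Theorem 3.1 (proof)] -/
theorem finrank_invariants_add_mul_le_finrank_intertwiningMap_of_one_le (hγ : 1 ≤ arithGenus (OrbitSurface G M)) :
    finrank ℂ ↥ρ.invariants + finrank ℂ V * (arithGenus (OrbitSurface G M) - 1) ≤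
      finrank ℂ (Representation.IntertwiningMap ρ ((oneFormRep M).comp G.subtype)) := by
  have h := finrank_invariants_add_mul_le_finrank_intertwiningMap G ρ
  have h1 : ((arithGenus (OrbitSurface G M) - 1 : ℕ) : ℤ) = (arithGenus (OrbitSurface G M) : ℤ) - 1 := by omega
  have h' : ((finrank ℂ ↥ρ.invariants + finrank ℂ V * (arithGenus (OrbitSurface G M) - 1) : ℕ) : ℤ) ≤
      (finrank ℂ (Representation.IntertwiningMap ρ ((oneFormRep M).comp G.subtype)) : ℤ) := by
    push_cast [h1]
    exact h
  exact_mod_cast h'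

/-- `dim V^G ≤ dim Hom_G(V, 𝓗¹(M))` when `γ ≥ 1` (the invariant differentials `V^G ⊗ 𝓗¹(M/G)` alone).
[cite: LangeRecillas2004, Theorem 3.1 (proof)] [cite: KopeliovichZemel2019, Proposition 7.1] -/
theorem finrank_invariants_le_finrank_intertwiningMap (hγ : 1 ≤ arithGenus (OrbitSurface G M)) :
    finrank ℂ ↥ρ.invariants ≤ finrank ℂ (Representation.IntertwiningMap ρ ((oneFormRep M).comp G.subtype)) :=
  le_trans (Nat.le_add_right _ _) (finrank_invariants_add_mul_le_finrank_intertwiningMap_of_one_le G ρ hγ)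

/-- **`γ ≥ 2 ⟹ dim V ≤ dim V·(γ − 1) ≤ dim Hom_G(V, 𝓗¹(M))`.** [cite: LangeRecillas2004, Theorem 3.1]
[cite: KopeliovichZemel2019, §7 (after Corollary 7.2)] -/
theorem finrank_le_finrank_intertwiningMap_of_two_le (hγ : 2 ≤ arithGenus (OrbitSurface G M)) :
    finrank ℂ V ≤ finrank ℂ (Representation.IntertwiningMap ρ ((oneFormRep M).comp G.subtype)) := by
  have h := finrank_invariants_add_mul_le_finrank_intertwiningMap_of_one_le G ρ (le_trans one_le_two hγ)
  have h2 : finrank ℂ V ≤ finrank ℂ V * (arithGenus (OrbitSurface G M) - 1) :=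
    Nat.le_mul_of_pos_right _ (by omega)
  omega

/-- **THEOREM 3.1 (Lange–Recillas) at `T₀`: if `g(M/G) ≥ 2`, every non-zero representation `V` of `G` occurs in
`𝓗¹(M)`** — `dim Hom_G(V, 𝓗¹(M)) > 0` («all irreducible representations of `G` appear in the isotypical
decomposition of `JX` if `g_Y ≥ 2`»; «the positivity … for `g_S ≥ 2`, which is Theorem 3.1 of [LR]»).
[cite: LangeRecillas2004, Theorem 3.1] [cite: KopeliovichZemel2019, §7 (after Corollary 7.2)] -/
theorem finrank_intertwiningMap_pos_of_two_le [Nontrivial V] (hγ : 2 ≤ arithGenus (OrbitSurface G M)) :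
    0 < finrank ℂ (Representation.IntertwiningMap ρ ((oneFormRep M).comp G.subtype)) :=
  lt_of_lt_of_le (Module.finrank_pos (R := ℂ) (M := V)) (finrank_le_finrank_intertwiningMap_of_two_le G ρ hγ)

/-- THEOREM 3.1 as the existence of a non-zero `G`-map `V → 𝓗¹(M)` for `g(M/G) ≥ 2`, `V ≠ 0`.
[cite: LangeRecillas2004, Theorem 3.1] -/
theorem nontrivial_intertwiningMap_of_two_le [Nontrivial V] (hγ : 2 ≤ arithGenus (OrbitSurface G M)) :
    Nontrivial (Representation.IntertwiningMap ρ ((oneFormRep M).comp G.subtype)) :=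
  Module.nontrivial_of_finrank_pos (finrank_intertwiningMap_pos_of_two_le G ρ hγ)

/-! ### §2 Corollary 7.4: `dim B_Q > 0 ⟺ g(Y_Q) ≥ 1`, unless `g(Y_Q) = g_S = 1` and `Q ≠ 1` -/

omit [IsManifold 𝓘(ℂ, ℂ) ω M] [CompactSpace M] [T2Space M] [PreconnectedSpace M] [Nonempty M]
  [Finite (autGroup M)] [Fintype ↥G] in
/-- `ker χ⁻¹ = ker χ` in `Ĝ`. [cite: KopeliovichZemel2019, Proposition 7.1 (proof: «χ_{ρ^*}(σ) = χ_ρ(σ⁻¹)»)] -/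
theorem ker_inv_char (χ : ↥G →* ℂˣ) : χ⁻¹.ker = χ.ker := by
  ext h
  rw [MonoidHom.mem_ker, MonoidHom.mem_ker, MonoidHom.inv_apply, inv_eq_one]

omit [CompactSpace M] [Nonempty M] [Fintype ↥G] in
/-- For `ψ` with `ker ψ = N`: `{q ∈ Br : ψ(G_q) ≠ 1} = {q ∈ Br : G_q ⊄ N}` (the two ways of counting the branch
values of `Y_Q → S`). [cite: KopeliovichZemel2019, Theorem 7.3 (proof: «N^W_{C,0} is 1 … if C ⊆ ker W and 0 otherwise»)] -/
theorem card_filter_exists_apply_ne_one_eq {ψ : ↥G →* ℂˣ} {N : Subgroup ↥G} (hψ : ψ.ker = N)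
    [DecidablePred fun q : OrbitSurface ↥G M ↦ ∃ h ∈ stabilizer (↥G) q.out, ψ h ≠ 1]
    [DecidablePred fun q : OrbitSurface ↥G M ↦ ¬ stabilizer (↥G) q.out ≤ N] :
    ((branchDiv (mk G : M → OrbitSurface G M)).support.filter fun q : OrbitSurface G M ↦
        ∃ h ∈ stabilizer (↥G) q.out, ψ h ≠ 1) =
      ((branchDiv (mk G : M → OrbitSurface G M)).support.filter fun q : OrbitSurface G M ↦
        ¬ stabilizer (↥G) q.out ≤ N) := by
  refine Finset.filter_congr fun q _ ↦ ?_
  rw [← hψ, SetLike.not_le_iff_exists]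
  simp only [MonoidHom.mem_ker, ne_eq]

omit [CompactSpace M] [Nonempty M] [Fintype ↥G] in
/-- For `ψ` trivial on `N`: `{q ∈ Br : ψ(G_q) ≠ 1} ⊆ {q ∈ Br : G_q ⊄ N}` (a branch value of the intermediate quotient
of `Y_Q` is a branch value of `Y_Q → S`). [cite: KopeliovichZemel2019, Corollary 7.4 (proof)] -/
theorem card_filter_exists_apply_ne_one_le {ψ : ↥G →* ℂˣ} {N : Subgroup ↥G} (hψ : N ≤ ψ.ker)
    [DecidablePred fun q : OrbitSurface ↥G M ↦ ∃ h ∈ stabilizer (↥G) q.out, ψ h ≠ 1]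
    [DecidablePred fun q : OrbitSurface ↥G M ↦ ¬ stabilizer (↥G) q.out ≤ N] :
    ((branchDiv (mk G : M → OrbitSurface G M)).support.filter fun q : OrbitSurface G M ↦
        ∃ h ∈ stabilizer (↥G) q.out, ψ h ≠ 1).card ≤
      ((branchDiv (mk G : M → OrbitSurface G M)).support.filter fun q : OrbitSurface G M ↦
        ¬ stabilizer (↥G) q.out ≤ N).card := by
  refine Finset.card_le_card fun q hq ↦ ?_
  rw [Finset.mem_filter] at hq ⊢
  obtain ⟨hq, h, hh, hne⟩ := hq
  exact ⟨hq, fun hle ↦ hne ((MonoidHom.mem_ker).1 (hψ (hle hh)))⟩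

omit [CompactSpace M] [Nonempty M] [Fintype ↥G] in
/-- The trivial character has no branch count: `{q ∈ Br : 1(G_q) ≠ 1} = ∅`. [cite: KopeliovichZemel2019, Proposition 7.1] -/
theorem filter_exists_apply_ne_one_eq_empty_one
    [DecidablePred fun q : OrbitSurface ↥G M ↦ ∃ h ∈ stabilizer (↥G) q.out, (1 : ↥G →* ℂˣ) h ≠ 1] :
    ((branchDiv (mk G : M → OrbitSurface G M)).support.filter fun q : OrbitSurface G M ↦
        ∃ h ∈ stabilizer (↥G) q.out, (1 : ↥G →* ℂˣ) h ≠ 1) = ∅ := by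
  refine Finset.filter_false_of_mem fun q _ ↦ ?_
  rintro ⟨h, -, hne⟩
  exact hne (MonoidHom.one_apply h)

open Classical in
/-- **THEOREM 7.3's `dim B_Q` over `ℤ`: `2·Σ_{ψ : ker ψ = N} dim E_ψ = φ([G:N])·(2γ − 2 + 2[N = G] + #{q ∈ Br : G_q ⊄ N})`**,
`N = ker χ`. [cite: KopeliovichZemel2019, Theorem 7.3] -/
theorem two_mul_sum_filter_ker_eq_finrank_eq_int [Fintype (↥G →* ℂˣ)] (χ : ↥G →* ℂˣ) :
    (2 * ((∑ ψ ∈ Finset.univ.filter (fun ψ : ↥G →* ℂˣ ↦ ψ.ker = χ.ker),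
        finrank ℂ ↥(⨅ h : ↥G, Module.End.eigenspace (oneFormRep M (h : autGroup M)) (ψ h : ℂ)) : ℕ) : ℤ)) =
      (χ.ker.index.totient : ℤ) *
        (2 * (arithGenus (OrbitSurface G M) : ℤ) - 2 + 2 * (if χ.ker = ⊤ then 1 else 0 : ℤ) +
          (((branchDiv (mk G : M → OrbitSurface G M)).support.filter fun q : OrbitSurface G M ↦
            ¬ stabilizer (↥G) q.out ≤ χ.ker).card : ℤ)) := by
  have h := sum_filter_ker_eq_finrank_iInf_eigenspace_eq G (M := M) χ
  have key : ((2 * ((∑ ψ ∈ Finset.univ.filter (fun ψ : ↥G →* ℂˣ ↦ ψ.ker = χ.ker),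
        finrank ℂ ↥(⨅ h : ↥G, Module.End.eigenspace (oneFormRep M (h : autGroup M)) (ψ h : ℂ)) : ℕ) : ℤ) : ℤ) : ℂ) =
      (((χ.ker.index.totient : ℤ) *
        (2 * (arithGenus (OrbitSurface G M) : ℤ) - 2 + 2 * (if χ.ker = ⊤ then 1 else 0 : ℤ) +
          (((branchDiv (mk G : M → OrbitSurface G M)).support.filter fun q : OrbitSurface G M ↦
            ¬ stabilizer (↥G) q.out ≤ χ.ker).card : ℤ)) : ℤ) : ℂ) := by
    push_cast
    rw [h]
    ring
  exact_mod_cast key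

open Classical in
/-- **`Σ_{ψ ∈ Ĝ : ψ(N) = 1} dim E_ψ = g(M/N)`** for `N = ker χ`, as a `Finset` sum (`𝓗¹(M)^N = ⊕_{ψ(N)=1} E_ψ` is
the pull-back of `𝓗¹(Y_Q)`). [cite: KopeliovichZemel2019, Corollary 7.4 (proof)] [cite: FarkasKra1992, V.2.2 Corollary] -/
theorem sum_filter_ker_le_finrank_eq_arithGenus [Fintype (↥G →* ℂˣ)] (χ : ↥G →* ℂˣ)
    [Fintype ↥(χ.ker.map G.subtype)] :
    ∑ ψ ∈ Finset.univ.filter (fun ψ : ↥G →* ℂˣ ↦ χ.ker ≤ ψ.ker),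
        finrank ℂ ↥(⨅ h : ↥G, Module.End.eigenspace (oneFormRep M (h : autGroup M)) (ψ h : ℂ)) =
      arithGenus (OrbitSurface ↥(χ.ker.map G.subtype) M) := by
  have h := finsum_mem_finrank_iInf_eigenspace_oneFormRep_eq_arithGenus G χ.ker
    (Abelianization.commutator_subset_ker χ)
  have hset : {ψ : ↥G →* ℂˣ | χ.ker ≤ ψ.ker} =
      ↑(Finset.univ.filter (fun ψ : ↥G →* ℂˣ ↦ χ.ker ≤ ψ.ker)) := by
    ext ψ
    simp only [Set.mem_setOf_eq, Finset.coe_filter, Finset.mem_univ, true_and]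
  rwa [hset, finsum_mem_coe_finset] at h

open Classical in
/-- **RIEMANN–HURWITZ FOR THE CYCLIC COVER `Y_Q = M/N → M/G` IN CHARACTER FORM:
`2g(M/N) = 2 + 2(γ − 1)[G:N] + Σ_{ψ ∈ Ĝ, ψ(N) = 1} #{q ∈ Br : ψ(G_q) ≠ 1}`**, `N = ker χ` — summing
`dim E_{ψ̄} + dim E_ψ = 2[ψ = 1] + 2(γ − 1) + #{q : ψ(G_q) ≠ 1}` over the `[G:N]` characters of `Q = G/N`
(compare Rojas' `2g(M/N) − 2 = [G:N](2γ − 2) + Σ_q ([G:N] − |N\G/G_q|)`).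
[cite: KopeliovichZemel2019, Proposition 7.1, Corollary 7.4 (proof)] [cite: Rojas2007, Corollary 3.4 (3.3)]
[cite: LangeRodriguez2022, Theorem 3.1.6] -/
theorem two_mul_arithGenus_orbitSurface_ker_eq [Fintype (↥G →* ℂˣ)] (χ : ↥G →* ℂˣ)
    [Fintype ↥(χ.ker.map G.subtype)] :
    (2 * arithGenus (OrbitSurface ↥(χ.ker.map G.subtype) M) : ℤ) =
      2 + 2 * ((arithGenus (OrbitSurface G M) : ℤ) - 1) * χ.ker.index +
        ((∑ ψ ∈ Finset.univ.filter (fun ψ : ↥G →* ℂˣ ↦ χ.ker ≤ ψ.ker),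
          ((branchDiv (mk G : M → OrbitSurface G M)).support.filter fun q : OrbitSurface G M ↦
            ∃ h ∈ stabilizer (↥G) q.out, ψ h ≠ 1).card : ℕ) : ℤ) := by
  -- notation-free bookkeeping
  have hg := sum_filter_ker_le_finrank_eq_arithGenus G (M := M) χ
  have hcard := card_filter_ker_le_eq_index χ.ker (Abelianization.commutator_subset_ker χ)
    (G := ↥G)
  -- the pair identity summed over `F = {ψ : ker χ ≤ ker ψ}`
  have hpair := fun ψ : ↥G →* ℂˣ ↦ finrank_iInf_eigenspace_char_inv_add_eq G (M := M) ψ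
  have hsum := Finset.sum_congr rfl fun ψ (_ : ψ ∈ Finset.univ.filter (fun ψ : ↥G →* ℂˣ ↦ χ.ker ≤ ψ.ker)) ↦
    hpair ψ
  rw [Finset.sum_add_distrib, Finset.sum_add_distrib, Finset.sum_add_distrib] at hsum
  -- `Σ_F dim E_{ψ̄} = Σ_F dim E_ψ` (reindex by `ψ ↦ ψ⁻¹`, `F` is inversion-stable)
  have hinv : ∑ ψ ∈ Finset.univ.filter (fun ψ : ↥G →* ℂˣ ↦ χ.ker ≤ ψ.ker),
      (finrank ℂ ↥(⨅ h : ↥G, Module.End.eigenspace (oneFormRep M (h : autGroup M)) ((ψ h : ℂ))⁻¹) : ℂ) =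
      ∑ ψ ∈ Finset.univ.filter (fun ψ : ↥G →* ℂˣ ↦ χ.ker ≤ ψ.ker),
        (finrank ℂ ↥(⨅ h : ↥G, Module.End.eigenspace (oneFormRep M (h : autGroup M)) (ψ h : ℂ)) : ℂ) := by
    refine Finset.sum_nbij' (fun ψ ↦ ψ⁻¹) (fun ψ ↦ ψ⁻¹) (fun ψ hψ ↦ ?_) (fun ψ hψ ↦ ?_)
      (fun ψ _ ↦ by ext x; rw [MonoidHom.inv_apply, MonoidHom.inv_apply, inv_inv])
      (fun ψ _ ↦ by ext x; rw [MonoidHom.inv_apply, MonoidHom.inv_apply, inv_inv]) (fun ψ _ ↦ ?_)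
    · rw [Finset.mem_filter] at hψ ⊢
      exact ⟨Finset.mem_univ _, by rw [ker_inv_char]; exact hψ.2⟩
    · rw [Finset.mem_filter] at hψ ⊢
      exact ⟨Finset.mem_univ _, by rw [ker_inv_char]; exact hψ.2⟩
    · have hE : (⨅ h : ↥G, Module.End.eigenspace (oneFormRep M (h : autGroup M)) ((ψ h : ℂ))⁻¹) =
          ⨅ h : ↥G, Module.End.eigenspace (oneFormRep M (h : autGroup M)) ((ψ⁻¹ h : ℂˣ) : ℂ) :=
        iInf_congr fun h ↦ by rw [MonoidHom.inv_apply, Units.val_inv_eq_inv_val]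
      rw [hE]
  -- `Σ_F [ψ = 1] = 1`
  have hone : ∑ ψ ∈ Finset.univ.filter (fun ψ : ↥G →* ℂˣ ↦ χ.ker ≤ ψ.ker),
      (2 * (if ψ = 1 then 1 else 0 : ℂ)) = 2 := by
    rw [← Finset.mul_sum, Finset.sum_ite_eq' (Finset.univ.filter (fun ψ : ↥G →* ℂˣ ↦ χ.ker ≤ ψ.ker)) 1
      (fun _ ↦ (1 : ℂ)), if_pos, mul_one]
    rw [Finset.mem_filter, MonoidHom.ker_one]
    exact ⟨Finset.mem_univ _, le_top⟩
  -- `Σ_F 2(γ − 1) = 2(γ − 1)[G:N]`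
  have hconst : ∑ ψ ∈ Finset.univ.filter (fun ψ : ↥G →* ℂˣ ↦ χ.ker ≤ ψ.ker),
      (2 * ((arithGenus (OrbitSurface G M) : ℂ) - 1)) =
      2 * ((arithGenus (OrbitSurface G M) : ℂ) - 1) * χ.ker.index := by
    rw [Finset.sum_const, hcard, nsmul_eq_mul]
    ring
  rw [hinv, hone, hconst, ← two_mul] at hsum
  -- `Σ_F dim E_ψ = g(M/N)`
  have hg' : ∑ ψ ∈ Finset.univ.filter (fun ψ : ↥G →* ℂˣ ↦ χ.ker ≤ ψ.ker),
      (finrank ℂ ↥(⨅ h : ↥G, Module.End.eigenspace (oneFormRep M (h : autGroup M)) (ψ h : ℂ)) : ℂ) =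
      (arithGenus (OrbitSurface ↥(χ.ker.map G.subtype) M) : ℂ) := by
    rw [← hg, Nat.cast_sum]
  rw [hg'] at hsum
  have key : ((2 * arithGenus (OrbitSurface ↥(χ.ker.map G.subtype) M) : ℤ) : ℂ) =
      ((2 + 2 * ((arithGenus (OrbitSurface G M) : ℤ) - 1) * χ.ker.index +
        ((∑ ψ ∈ Finset.univ.filter (fun ψ : ↥G →* ℂˣ ↦ χ.ker ≤ ψ.ker),
          ((branchDiv (mk G : M → OrbitSurface G M)).support.filter fun q : OrbitSurface G M ↦
            ∃ h ∈ stabilizer (↥G) q.out, ψ h ≠ 1).card : ℕ) : ℤ) : ℤ) : ℂ) := by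
    push_cast
    rw [hsum]
  exact_mod_cast key

open Classical in
/-- `Σ_{ψ : ker ψ = N} dim E_ψ ≤ g(M/N)` (`B_Q ⊆ J(Y_Q)`: the characters with kernel exactly `N` are among those
trivial on `N`). [cite: KopeliovichZemel2019, Corollary 7.4 (proof)] -/
theorem sum_filter_ker_eq_finrank_le_arithGenus [Fintype (↥G →* ℂˣ)] (χ : ↥G →* ℂˣ)
    [Fintype ↥(χ.ker.map G.subtype)] :
    ∑ ψ ∈ Finset.univ.filter (fun ψ : ↥G →* ℂˣ ↦ ψ.ker = χ.ker),
        finrank ℂ ↥(⨅ h : ↥G, Module.End.eigenspace (oneFormRep M (h : autGroup M)) (ψ h : ℂ)) ≤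
      arithGenus (OrbitSurface ↥(χ.ker.map G.subtype) M) := by
  rw [← sum_filter_ker_le_finrank_eq_arithGenus G χ]
  refine Finset.sum_le_sum_of_subset fun ψ hψ ↦ ?_
  rw [Finset.mem_filter] at hψ ⊢
  exact ⟨hψ.1, hψ.2.symm.le⟩

open Classical in
/-- **COROLLARY 7.4 (third assertion) and the remark after it, at `T₀`: for `χ ∈ Ĝ`, `N = ker χ`, `Y_Q = M/N`,
`Σ_{ψ : ker ψ = N} dim E_ψ > 0 ⟺ g(Y_Q) ≥ 1 and not (g(Y_Q) = 1, g(M/G) = 1, χ ≠ 1)`** («the primitive Prym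
variety associated with the cyclic quotient `Q` is non-trivial wherever `g_{Y_Q} ≥ 1`, except when
`g_{Y_Q} = g_S = 1` and `Q` is not trivial»; «in the cases not covered … `P̃(Y_Q/S)` is trivial»).
[cite: KopeliovichZemel2019, Corollary 7.4, remark after Corollary 7.4] -/
theorem sum_filter_ker_eq_finrank_pos_iff [Fintype (↥G →* ℂˣ)] (χ : ↥G →* ℂˣ)
    [Fintype ↥(χ.ker.map G.subtype)] :
    0 < ∑ ψ ∈ Finset.univ.filter (fun ψ : ↥G →* ℂˣ ↦ ψ.ker = χ.ker),
        finrank ℂ ↥(⨅ h : ↥G, Module.End.eigenspace (oneFormRep M (h : autGroup M)) (ψ h : ℂ)) ↔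
      1 ≤ arithGenus (OrbitSurface ↥(χ.ker.map G.subtype) M) ∧
        ¬ (arithGenus (OrbitSurface ↥(χ.ker.map G.subtype) M) = 1 ∧ arithGenus (OrbitSurface G M) = 1 ∧ χ ≠ 1) := by
  -- the integer data
  have h1 := two_mul_sum_filter_ker_eq_finrank_eq_int G (M := M) χ
  have hd := two_mul_arithGenus_orbitSurface_ker_eq G (M := M) χ
  have h3 := sum_filter_ker_eq_finrank_le_arithGenus G (M := M) χ
  have hn : 1 ≤ χ.ker.index := Nat.pos_of_ne_zero Subgroup.index_ne_zero_of_finite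
  have hφ : (χ.ker.index.totient : ℤ) ≠ 0 := by
    exact_mod_cast (Nat.totient_pos.2 hn).ne'
  -- the branch counts: `k_χ ≤ K`, `k_1 = 0`, `K ≤ ([G:N] − 1)·k_χ`
  set K := ∑ ψ ∈ Finset.univ.filter (fun ψ : ↥G →* ℂˣ ↦ χ.ker ≤ ψ.ker),
      ((branchDiv (mk G : M → OrbitSurface G M)).support.filter fun q : OrbitSurface G M ↦
        ∃ h ∈ stabilizer (↥G) q.out, ψ h ≠ 1).card with hK
  set k := ((branchDiv (mk G : M → OrbitSurface G M)).support.filter fun q : OrbitSurface G M ↦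
      ¬ stabilizer (↥G) q.out ≤ χ.ker).card with hk
  have hχmem : χ ∈ Finset.univ.filter (fun ψ : ↥G →* ℂˣ ↦ χ.ker ≤ ψ.ker) :=
    Finset.mem_filter.2 ⟨Finset.mem_univ _, le_rfl⟩
  have hkK : k ≤ K := by
    have := Finset.single_le_sum (f := fun ψ : ↥G →* ℂˣ ↦
      ((branchDiv (mk G : M → OrbitSurface G M)).support.filter fun q : OrbitSurface G M ↦
        ∃ h ∈ stabilizer (↥G) q.out, ψ h ≠ 1).card) (fun _ _ ↦ Nat.zero_le _) hχmem
    rwa [card_filter_exists_apply_ne_one_eq G rfl] at this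
  have hKle : K ≤ (χ.ker.index - 1) * k := by
    have h1mem : (1 : ↥G →* ℂˣ) ∈ Finset.univ.filter (fun ψ : ↥G →* ℂˣ ↦ χ.ker ≤ ψ.ker) := by
      rw [Finset.mem_filter, MonoidHom.ker_one]
      exact ⟨Finset.mem_univ _, le_top⟩
    rw [hK, ← Finset.sum_erase _ (a := (1 : ↥G →* ℂˣ))
      (Finset.card_eq_zero.2 (filter_exists_apply_ne_one_eq_empty_one G)),
      ← card_filter_ker_le_eq_index χ.ker (Abelianization.commutator_subset_ker χ) (G := ↥G),
      ← Finset.card_erase_of_mem h1mem, ← smul_eq_mul]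
    refine Finset.sum_le_card_nsmul _ _ _ fun ψ hψ ↦ ?_
    exact card_filter_exists_apply_ne_one_le G (Finset.mem_filter.1 (Finset.mem_of_mem_erase hψ)).2
  have hK0 : k = 0 → K = 0 := fun h0 ↦ by rw [h0, mul_zero] at hKle; omega
  have hK2 : k ≤ 2 → K ≤ 2 * (χ.ker.index - 1) := fun h2 ↦
    hKle.trans ((Nat.mul_le_mul_left _ h2).trans (le_of_eq (mul_comm _ _)))
  have hKn : χ.ker.index = 1 → K = 0 := fun hn1 ↦ by rw [hn1] at hKle; omega
  -- `B = 0 ⟺ 2γ − 2 + 2δ + k = 0`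
  have hBX : ((∑ ψ ∈ Finset.univ.filter (fun ψ : ↥G →* ℂˣ ↦ ψ.ker = χ.ker),
      finrank ℂ ↥(⨅ h : ↥G, Module.End.eigenspace (oneFormRep M (h : autGroup M)) (ψ h : ℂ)) : ℕ) : ℤ) = 0 ↔
      2 * (arithGenus (OrbitSurface G M) : ℤ) - 2 + 2 * (if χ.ker = ⊤ then 1 else 0 : ℤ) + (k : ℤ) = 0 := by
    constructor
    · intro hB
      rw [hB, mul_zero] at h1
      exact (mul_eq_zero.1 h1.symm).resolve_left hφ
    · intro hX
      rw [hX, mul_zero] at h1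
      omega
  by_cases htop : χ.ker = ⊤
  · have hχ : χ = 1 := MonoidHom.ker_eq_top_iff.1 htop
    have hn1 : χ.ker.index = 1 := Subgroup.index_eq_one.2 htop
    have hK' : K = 0 := hKn hn1
    rw [if_pos htop] at hBX
    rw [hn1, hK'] at hd
    have hne : ¬ (arithGenus (OrbitSurface ↥(χ.ker.map G.subtype) M) = 1 ∧ arithGenus (OrbitSurface G M) = 1 ∧
        χ ≠ 1) := fun h ↦ h.2.2 hχ
    simp only [hne, not_false_eq_true, and_true]
    norm_num at hd
    omega
  · have hχ : χ ≠ 1 := fun h ↦ htop (MonoidHom.ker_eq_top_iff.2 h)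
    have hn1 : χ.ker.index ≠ 1 := fun h ↦ htop (Subgroup.index_eq_one.1 h)
    rw [if_neg htop] at hBX
    simp only [hχ, ne_eq, not_false_eq_true, and_true]
    rcases Nat.lt_or_ge (arithGenus (OrbitSurface G M)) 2 with hγ | hγ
    · rcases (show arithGenus (OrbitSurface G M) = 0 ∨ arithGenus (OrbitSurface G M) = 1 by omega) with h0 | h1'
      · rw [h0] at hd hBX ⊢
        norm_num at hd
        omega
      · rw [h1'] at hd hBX ⊢
        norm_num at hd
        omega
    · omega

open Classical in
/-- **«The positivity of the dimensions of these subvarieties for `g_S ≥ 2`»**: `g(M/G) ≥ 2 ⟹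
Σ_{ψ : ker ψ = ker χ} dim E_ψ > 0` for every `χ ∈ Ĝ` (every `B_Q` is non-trivial).
[cite: KopeliovichZemel2019, §7 (after Corollary 7.2)] [cite: LangeRecillas2004, Theorem 3.1] -/
theorem sum_filter_ker_eq_finrank_pos_of_two_le [Fintype (↥G →* ℂˣ)] (χ : ↥G →* ℂˣ)
    (hγ : 2 ≤ arithGenus (OrbitSurface G M)) :
    0 < ∑ ψ ∈ Finset.univ.filter (fun ψ : ↥G →* ℂˣ ↦ ψ.ker = χ.ker),
        finrank ℂ ↥(⨅ h : ↥G, Module.End.eigenspace (oneFormRep M (h : autGroup M)) (ψ h : ℂ)) := by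
  have h1 := two_mul_sum_filter_ker_eq_finrank_eq_int G (M := M) χ
  have hn : 1 ≤ χ.ker.index := Nat.pos_of_ne_zero Subgroup.index_ne_zero_of_finite
  have hφ : 1 ≤ (χ.ker.index.totient : ℤ) := by exact_mod_cast Nat.totient_pos.2 hn
  have hX : 2 ≤ 2 * (arithGenus (OrbitSurface G M) : ℤ) - 2 + 2 * (if χ.ker = ⊤ then 1 else 0 : ℤ) +
      (((branchDiv (mk G : M → OrbitSurface G M)).support.filter fun q : OrbitSurface G M ↦
        ¬ stabilizer (↥G) q.out ≤ χ.ker).card : ℤ) := by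
    have : (0 : ℤ) ≤ (if χ.ker = ⊤ then 1 else 0 : ℤ) := by split_ifs <;> norm_num
    have hγ' : (2 : ℤ) ≤ arithGenus (OrbitSurface G M) := by exact_mod_cast hγ
    linarith [Int.natCast_nonneg (((branchDiv (mk G : M → OrbitSurface G M)).support.filter
      fun q : OrbitSurface G M ↦ ¬ stabilizer (↥G) q.out ≤ χ.ker).card)]
  have h2 := mul_le_mul hφ hX (by norm_num) (by linarith)
  rw [one_mul, ← h1] at h2
  omega

open Classical in
/-- «If `g_{Y_Q} = 0` then `J(Y_Q)` itself is trivial»: `g(M/ker χ) = 0 ⟹ Σ_{ψ : ker ψ = ker χ} dim E_ψ = 0`.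
[cite: KopeliovichZemel2019, remark after Corollary 7.4] -/
theorem sum_filter_ker_eq_finrank_eq_zero_of_arithGenus_eq_zero [Fintype (↥G →* ℂˣ)] (χ : ↥G →* ℂˣ)
    [Fintype ↥(χ.ker.map G.subtype)] (h0 : arithGenus (OrbitSurface ↥(χ.ker.map G.subtype) M) = 0) :
    ∑ ψ ∈ Finset.univ.filter (fun ψ : ↥G →* ℂˣ ↦ ψ.ker = χ.ker),
        finrank ℂ ↥(⨅ h : ↥G, Module.End.eigenspace (oneFormRep M (h : autGroup M)) (ψ h : ℂ)) = 0 := by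
  have h := sum_filter_ker_eq_finrank_le_arithGenus G (M := M) χ
  omega

open Classical in
/-- «If `Y_Q` is a non-trivial unbranched cover of `S` and both have genus 1 then `J(Y_Q)` is the image of `J(S)`»:
`g(M/ker χ) = g(M/G) = 1` and `χ ≠ 1 ⟹ Σ_{ψ : ker ψ = ker χ} dim E_ψ = 0`.
[cite: KopeliovichZemel2019, remark after Corollary 7.4] -/
theorem sum_filter_ker_eq_finrank_eq_zero_of_arithGenus_eq_one [Fintype (↥G →* ℂˣ)] (χ : ↥G →* ℂˣ)
    [Fintype ↥(χ.ker.map G.subtype)] (hY : arithGenus (OrbitSurface ↥(χ.ker.map G.subtype) M) = 1)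
    (hγ : arithGenus (OrbitSurface G M) = 1) (hχ : χ ≠ 1) :
    ∑ ψ ∈ Finset.univ.filter (fun ψ : ↥G →* ℂˣ ↦ ψ.ker = χ.ker),
        finrank ℂ ↥(⨅ h : ↥G, Module.End.eigenspace (oneFormRep M (h : autGroup M)) (ψ h : ℂ)) = 0 := by
  have h := sum_filter_ker_eq_finrank_pos_iff G (M := M) χ
  by_contra hne
  exact ((h.1 (Nat.pos_of_ne_zero hne)).2 ⟨hY, hγ, hχ⟩).elim

end RiemannSurface

end Literature.Geometry.Kaehler
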